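import Literature.AlgebraicGeometry.Motives.GrothendieckComplexCechProofs
import Literature.AlgebraicGeometry.Motives.CechComplexH0Fibre
import HarnessLib

/-!
# `grothendieckComplex_h0` holds (Görtz–Wedhorn II, Cor. 23.135 with (23.28.5); Thm. 23.139 (2), Thm. 24.66 (3))

Discharge of the named fact `grothendieckComplex_h0` of `Motives/SemicontinuityGrothendieckComplex`
(the degree-`0` Grothendieck complex of `𝒪(D)` on `pr_T : X ×_K T → T`: locally on `T` a matrix of
regular functions `M` with `H⁰(X_t, 𝒪(D_t)) ≅ Ker M(t)` for all `t`), together with the two named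
facts it was vendored to support — `semicontinuity_isClosed_sectionLocus`
(`Motives/SeesawSemicontinuity`, Thm. 23.139 (2) for `i = 0`, `n = 1`, `𝓕 = 𝒪(D)`) and
`seesaw_isClosed_trivialLocus` (`Motives/SeesawTheorem`, Thm. 24.66 (3)).

The printed proof of Cor. 23.135 / Cor. 23.137 (pp. 478–480: the Čech complex of an `S`-flat module
over an affine base is a bounded complex of flat modules computing `Rf_*𝓕` and all its base changes;
it is pseudo-coherent by Thm. 23.133 — finiteness of coherent cohomology of proper morphisms plus
noetherian approximation — hence quasi-isomorphic to a bounded above complex of finite free modules,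
Prop. 22.53 / Cor. 22.62; and `H⁰` of the fibre is the kernel of the base-changed first differential,
(23.28.5)) is already assembled in the tree, step by step:

* `cechComplex_pseudoCoherent_holds` (`Motives/GrothendieckComplexCechProofs`, from
  `cechComplex_pseudoCoherent_general_holds` of `Motives/CechComplexPseudoCoherentGeneralProofs`):
  the ordered Čech complex `Č•(𝔚, 𝒪(D)|_{pr_T⁻¹V})` over an affine open `V ⊆ T` receives a
  quasi-isomorphism from a bounded above complex of finitely generated free `Γ(V, 𝒪_T)`-modules
  (Thm. 23.133 / Cor. 23.135);
* `cechComplex_perfect_of_pseudoCoherent` (`Motives/GrothendieckComplexCech`): hence from a finite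
  complex of finitely generated projective modules in degrees `≥ 0` (Prop. 22.53, the Čech complex
  being a bounded complex of flat modules);
* `cechComplex_h0_fibre_holds` and `grothendieckComplex_h0_of_perfect` (`Motives/CechComplexH0Fibre`):
  `H⁰(X_t, 𝒪(D_t)) ≅ Ker(d⁰_Č ⊗ κ(t))` ((23.28.5) in degree `0`), and the passage from the perfect
  complex to a matrix chart around each `t₀` (`grothendieckComplex_h0_of_cech`, proof of Prop. 23.117).

This file only composes them; no statement is changed and no named fact is introduced. The
discharge cannot sit next to the `def` in `Motives/SemicontinuityGrothendieckComplex` because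
`Motives/GrothendieckComplexCech` imports that file (import cycle), whence this `…Proofs` leaf.

## References

* U. Görtz, T. Wedhorn, *Algebraic Geometry II: Cohomology of Schemes. With Examples and
  Exercises*, Springer Spektrum (2023), doi:10.1007/978-3-658-43031-3: Prop. 22.53 (p. 360);
  Prop. 23.117 and its proof (p. 466); Thm. 23.133, Rem. 23.134, Cor. 23.135, Cor. 23.137
  (pp. 478–480); (23.28.5) and Thm. 23.139 (pp. 481–483); Thm. 24.66 (3) and its proof
  (pp. 545–546). [GortzWedhorn2023]
* D. Mumford, *Abelian Varieties*, TIFR Studies in Mathematics 5 (1970), §5 (the Grothendieck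
  complex and the semicontinuity theorem). [MumfordAV1970]
-/

namespace Literature.AlgebraicGeometry.Motives

universe u

/-- **The Grothendieck complex of `𝒪(D)` on `X ×_K T → T` in degree `0` exists** (Görtz–Wedhorn II,
Cor. 23.135 with Rem. 23.134, Prop. 22.53, (23.28.5) and Cor. 23.137): the named fact
`grothendieckComplex_h0` of `Motives/SemicontinuityGrothendieckComplex` holds — for `K` a field,
`X → Spec K` proper and geometrically integral, `T` an integral `K`-scheme with `X ×_K T` integral and
`D` a Cartier divisor on `X ×_K T`, every `t₀ ∈ T` has an open neighbourhood `V` and a matrix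
`M ∈ Mat_{n × m}(Γ(V, 𝒪_T))` with `H⁰(X_t, 𝒪(D_t)) ≅ Ker M(t)` (`κ(t)`-linearly) for every `t ∈ V`.
Proof: `grothendieckComplex_h0_of_perfect` applied to the perfectness of the Čech complex
(`cechComplex_perfect_of_pseudoCoherent cechComplex_pseudoCoherent_holds`).
[cite: GortzWedhorn2023, Cor. 23.135 with Rem. 23.134, Prop. 22.53, (23.28.5) and Cor. 23.137 (pp. 360, 480–482)] -/
theorem grothendieckComplex_h0_holds : grothendieckComplex_h0.{u} :=
  grothendieckComplex_h0_of_perfect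
    (cechComplex_perfect_of_pseudoCoherent cechComplex_pseudoCoherent_holds)

/-- **Görtz–Wedhorn II, Thm. 23.139 (2) for `i = 0`, `n = 1`, `𝓕 = 𝒪(D)` on `pr_T : X ×_K T → T`**:
the named fact `semicontinuity_isClosed_sectionLocus` of `Motives/SeesawSemicontinuity` holds — the
section locus `N(D) = {t ∈ T ; H⁰(X_t, 𝒪(D_t)) ≠ 0}` is closed in `T`
(`semicontinuity_isClosed_sectionLocus_of_grothendieckComplex` with `grothendieckComplex_h0_holds`).
[cite: GortzWedhorn2023, Thm. 23.139 (2) (p. 482), proof via Prop. 23.117 (p. 466)] -/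
theorem semicontinuity_isClosed_sectionLocus_holds : semicontinuity_isClosed_sectionLocus.{u} :=
  semicontinuity_isClosed_sectionLocus_of_grothendieckComplex grothendieckComplex_h0_holds

/-- **Görtz–Wedhorn II, Thm. 24.66 (3) (the seesaw theorem, closedness of the trivial locus)**: the
named fact `seesaw_isClosed_trivialLocus` of `Motives/SeesawTheorem` holds — for `X → Spec K` proper
and geometrically integral, `T` an integral `K`-scheme with `X ×_K T` integral and `D` a Cartier
divisor on `X ×_K T`, the locus `Z = {t ∈ T ; 𝒪(D)|_{X_t} trivial}` is closed in `T`
(`seesaw_isClosed_trivialLocus_of_grothendieckComplex` with `grothendieckComplex_h0_holds`, i.e.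
Lemma 24.65 and Thm. 23.139 (2) along the printed proof).
[cite: GortzWedhorn2023, Thm. 24.66 (3), proof (pp. 545–546)] -/
theorem seesaw_isClosed_trivialLocus_holds : seesaw_isClosed_trivialLocus.{u} :=
  seesaw_isClosed_trivialLocus_of_grothendieckComplex grothendieckComplex_h0_holds

end Literature.AlgebraicGeometry.Motives
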